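import Summits.QuantumFields.YangMills.Theorems.AllWindowsColdBoxBoxHighLineSmearedFPPauli
import Summits.QuantumFields.YangMills.Theorems.AllWindowsColdBoxBoxHighLineSmearedFPOperator
import Summits.QuantumFields.YangMills.Theorems.AllWindowsColdBoxBoxHighLineSmearedFPParityLink
import Literature.MathematicalPhysics.QuantumFieldTheory.Balaban1983to89.B13HaarSigmaJacobian
import Mathlib
import HarnessLib

/-!
# TASK T-S5/U5.4J, brick J1 (part 1/2, CHART LEVEL): the interior gauge orbit in the right-trivialised Pauli chart — the shift to the
# base point, the chart map `κ_A` and its derivative, and the ambient link functional `Θ̂` with its derivative at the identity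
# (planner ym-idea-2 g18, 2026-08-29T18:11:01Z «w3 = J1 OrbitMapJacobianDet»; LINE-19 ⟨stmt-QuantumFields-24004⟩/⟨24335⟩, LINE-20 ⟨24336⟩)

Free-hands work of width seat `ym-line-sfw-p2-w3` (g39, cell `ym-idea-1`).  `M = M₂(ℂ)` with the ℓ∞-operator norm (a real Banach algebra),
`I = interiorSites H`, `X = su2Coord`.

* `extMat` / `ext0` — extension of `k : I → M` by `1` / by `0` off the interior;
* `thetaHat H W k (x,c) = Σ_μ imVecM(k♯_{x−e_μ}·W_{(x−e_μ,μ)}·(k♯_x)ᴴ) − imVecM(k♯_x·W_{(x,μ)}·(k♯_{x+e_μ})ᴴ)` — the divergence defect of the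
  configuration `W` moved by an AMBIENT field of matrices (a quadratic polynomial in `k`); `thetaLin H W` its linearisation at `k ≡ 1`
  (a continuous linear map) and `hasFDerivAt_thetaHat_one` (the remainder is the exact bilinear cross term, `≤ 32‖δ‖²`);
* `chartK H A w y = exp X(A_y + w_y) · exp(−X(A_y))` — the right-trivialised chart at `A` — with `hasFDerivAt_chartK`
  (✓`hasFDerivAt_exp_mul_exp_neg`: derivative `⊕_y gSer(ad(−X A_y)) ∘ X`), `chartK_zero : chartK H A 0 = 1`;
* `coe_gaugeTransformZd_pauliGauge_add` — THE SHIFT: the links of `V^{pauliGauge (A + B)}` are `k_a · (V^{pauliGauge A})_e · k_bᴴ` with `k = chartK H A ♭B`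
  (left action + unitarity `exp(−X)·exp(X) = 1`).

Part 2 (`…SmearedFPOrbitJacobian`) assembles `HasFDerivAt (orbitMapFlat H V) (thetaLin ∘ Dκ) v`, identifies the derivative with
`fpLinear H (V^{pauliGauge A}) ∘ ⊕_y jac(−X A_y)` and computes the determinant.  Mathlib + tree only; no `sorry`.

HONEST LABEL: one brick of step (1b)/(J) of the XL stubs S5/U5; T-S5.4J, S5, U5, ⟨24004⟩ ⟨24335⟩ ⟨24336⟩ remain OPEN; no crux, rung or summit is
proved; the Yang–Mills mass gap is NOT proved by this file.
-/

set_option autoImplicit false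

noncomputable section

open Matrix Finset Filter Asymptotics Topology NormedSpace
open scoped Matrix.Norms.Operator
open Literature.MathematicalPhysics.QuantumFieldTheory.Balaban1983to89.B10Eq18SigmaSU2 (su2Coord)
open Literature.MathematicalPhysics.QuantumFieldTheory.Balaban1983to89.B10Eq18SigmaSU2Haar (expPauli coe_expPauli expPauli_zero)
open Literature.MathematicalPhysics.QuantumFieldTheory.Balaban1983to89.B13HaarSigmaJacobian (hasFDerivAt_exp_mul_exp_neg)
open Literature.Analysis.Calculus.ExpDifferential (gSer ad exp_neg_mul_exp_eq_one exp_mul_exp_neg_eq_one)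
open Literature.MathematicalPhysics.QuantumLattice (LGConfig ZdEdge gaugeTransformZd)
open Literature.Probability.LatticeModels (Site)
open Summit.QuantumFields.YangMills.Theorems.CoarseStiffnessTailCommutatorChart (star_su2Coord)

namespace Summit.QuantumFields.YangMills.Theorems.AllWindowsColdBoxBoxHighLine

namespace OrbitChart

/-! ## Extensions off the interior -/

/-- Extension of an interior field of matrices by the identity. [problem-side definition] -/
def extMat (H : ℕ) (k : ↥(interiorSites H) → Matrix (Fin 2) (Fin 2) ℂ) (z : Site 4) : Matrix (Fin 2) (Fin 2) ℂ :=
  if hz : z ∈ interiorSites H then k ⟨z, hz⟩ else 1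

/-- Extension of an interior field of matrices by zero. [problem-side definition] -/
def ext0 (H : ℕ) (δ : ↥(interiorSites H) → Matrix (Fin 2) (Fin 2) ℂ) (z : Site 4) : Matrix (Fin 2) (Fin 2) ℂ :=
  if hz : z ∈ interiorSites H then δ ⟨z, hz⟩ else 0

/-- `extMat` on the interior. -/
theorem extMat_of_mem {H : ℕ} (k : ↥(interiorSites H) → Matrix (Fin 2) (Fin 2) ℂ) {z : Site 4} (hz : z ∈ interiorSites H) :
    extMat H k z = k ⟨z, hz⟩ := by unfold extMat; rw [dif_pos hz]
/-- `extMat` off the interior. -/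
theorem extMat_of_not_mem {H : ℕ} (k : ↥(interiorSites H) → Matrix (Fin 2) (Fin 2) ℂ) {z : Site 4} (hz : z ∉ interiorSites H) :
    extMat H k z = 1 := by unfold extMat; rw [dif_neg hz]
/-- `ext0` on the interior. -/
theorem ext0_of_mem {H : ℕ} (δ : ↥(interiorSites H) → Matrix (Fin 2) (Fin 2) ℂ) {z : Site 4} (hz : z ∈ interiorSites H) :
    ext0 H δ z = δ ⟨z, hz⟩ := by unfold ext0; rw [dif_pos hz]
/-- `ext0` off the interior. -/
theorem ext0_of_not_mem {H : ℕ} (δ : ↥(interiorSites H) → Matrix (Fin 2) (Fin 2) ℂ) {z : Site 4} (hz : z ∉ interiorSites H) :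
    ext0 H δ z = 0 := by unfold ext0; rw [dif_neg hz]

/-- `extMat (1 + δ) = 1 + ext0 δ`. -/
theorem extMat_one_add {H : ℕ} (δ : ↥(interiorSites H) → Matrix (Fin 2) (Fin 2) ℂ) (z : Site 4) :
    extMat H ((fun _ => (1 : Matrix (Fin 2) (Fin 2) ℂ)) + δ) z = 1 + ext0 H δ z := by
  by_cases hz : z ∈ interiorSites H
  · rw [extMat_of_mem _ hz, ext0_of_mem _ hz]; rfl
  · rw [extMat_of_not_mem _ hz, ext0_of_not_mem _ hz, add_zero]

/-- `extMat 1 = 1`. -/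
theorem extMat_one {H : ℕ} (z : Site 4) : extMat H (fun _ => (1 : Matrix (Fin 2) (Fin 2) ℂ)) z = 1 := by
  by_cases hz : z ∈ interiorSites H
  · rw [extMat_of_mem _ hz]
  · rw [extMat_of_not_mem _ hz]

/-- `ext0` is additive. -/
theorem ext0_add {H : ℕ} (δ δ' : ↥(interiorSites H) → Matrix (Fin 2) (Fin 2) ℂ) (z : Site 4) :
    ext0 H (δ + δ') z = ext0 H δ z + ext0 H δ' z := by
  by_cases hz : z ∈ interiorSites H
  · simp only [ext0_of_mem _ hz, Pi.add_apply]
  · simp only [ext0_of_not_mem _ hz, add_zero]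

/-- `ext0` is homogeneous. -/
theorem ext0_smul {H : ℕ} (r : ℝ) (δ : ↥(interiorSites H) → Matrix (Fin 2) (Fin 2) ℂ) (z : Site 4) :
    ext0 H (r • δ) z = r • ext0 H δ z := by
  by_cases hz : z ∈ interiorSites H
  · simp only [ext0_of_mem _ hz, Pi.smul_apply]
  · simp only [ext0_of_not_mem _ hz, smul_zero]

/-- `‖ext0 δ z‖ ≤ ‖δ‖`. -/
theorem norm_ext0_le {H : ℕ} (δ : ↥(interiorSites H) → Matrix (Fin 2) (Fin 2) ℂ) (z : Site 4) : ‖ext0 H δ z‖ ≤ ‖δ‖ := by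
  by_cases hz : z ∈ interiorSites H
  · rw [ext0_of_mem _ hz]; exact norm_le_pi_norm δ _
  · rw [ext0_of_not_mem _ hz, norm_zero]; exact norm_nonneg _

/-- `‖Xᴴ‖ ≤ 2‖X‖` for `2 × 2` matrices in the ℓ∞-operator norm. -/
theorem norm_star_le (X : Matrix (Fin 2) (Fin 2) ℂ) : ‖star X‖ ≤ 2 * ‖X‖ := by
  refine linfty_opNorm_le_of_rows (by positivity) fun i => ?_
  have h0 := norm_entry_le_linfty_opNorm X 0 i
  have h1 := norm_entry_le_linfty_opNorm X 1 i
  rw [Matrix.star_apply, Matrix.star_apply, norm_star, norm_star]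
  linarith

/-! ## The ambient link functional `Θ̂` and its linearisation at the identity -/

/-- `Θ̂`: the divergence defect of `W` moved by an ambient interior field of matrices `k` (inverse replaced by the adjoint).
[problem-side definition] -/
def thetaHat (H : ℕ) (W : LGConfig 4 SU2) (k : ↥(interiorSites H) → Matrix (Fin 2) (Fin 2) ℂ)
    (p : ↥(interiorSites H) × Fin 3) : ℝ :=
  ∑ μ : Fin 4,
    (imVecM (extMat H k ((p.1 : Site 4) - Pi.single μ 1) * (W ((p.1 : Site 4) - Pi.single μ 1, μ) : Matrix (Fin 2) (Fin 2) ℂ)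
        * star (extMat H k (p.1 : Site 4))) p.2
      - imVecM (extMat H k (p.1 : Site 4) * (W ((p.1 : Site 4), μ) : Matrix (Fin 2) (Fin 2) ℂ)
        * star (extMat H k ((p.1 : Site 4) + Pi.single μ 1))) p.2)

/-- The linearisation of `Θ̂` at `k ≡ 1`, as a function. -/
def thetaLinFun (H : ℕ) (W : LGConfig 4 SU2) (δ : ↥(interiorSites H) → Matrix (Fin 2) (Fin 2) ℂ)
    (p : ↥(interiorSites H) × Fin 3) : ℝ :=
  ∑ μ : Fin 4,
    (imVecM (ext0 H δ ((p.1 : Site 4) - Pi.single μ 1) * (W ((p.1 : Site 4) - Pi.single μ 1, μ) : Matrix (Fin 2) (Fin 2) ℂ)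
        + (W ((p.1 : Site 4) - Pi.single μ 1, μ) : Matrix (Fin 2) (Fin 2) ℂ) * star (ext0 H δ (p.1 : Site 4))) p.2
      - imVecM (ext0 H δ (p.1 : Site 4) * (W ((p.1 : Site 4), μ) : Matrix (Fin 2) (Fin 2) ℂ)
        + (W ((p.1 : Site 4), μ) : Matrix (Fin 2) (Fin 2) ℂ) * star (ext0 H δ ((p.1 : Site 4) + Pi.single μ 1))) p.2)

/-- `thetaLinFun` is additive. -/
theorem thetaLinFun_add (H : ℕ) (W : LGConfig 4 SU2) (δ δ' : ↥(interiorSites H) → Matrix (Fin 2) (Fin 2) ℂ) :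
    thetaLinFun H W (δ + δ') = thetaLinFun H W δ + thetaLinFun H W δ' := by
  funext p
  simp only [thetaLinFun, Pi.add_apply, ext0_add, add_mul, mul_add, star_add, imVecM_add, ← Finset.sum_add_distrib]
  refine Finset.sum_congr rfl fun μ _ => ?_
  ring

/-- `thetaLinFun` is homogeneous. -/
theorem thetaLinFun_smul (H : ℕ) (W : LGConfig 4 SU2) (r : ℝ) (δ : ↥(interiorSites H) → Matrix (Fin 2) (Fin 2) ℂ) :
    thetaLinFun H W (r • δ) = r • thetaLinFun H W δ := by
  funext p
  simp only [thetaLinFun, Pi.smul_apply, ext0_smul, smul_mul_assoc, mul_smul_comm, star_smul, star_trivial, ← smul_add,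
    imVecM_smul, smul_eq_mul, Finset.mul_sum, mul_sub]

/-- **The linearisation of `Θ̂` at the identity, as a continuous linear map.** -/
def thetaLin (H : ℕ) (W : LGConfig 4 SU2) :
    (↥(interiorSites H) → Matrix (Fin 2) (Fin 2) ℂ) →L[ℝ] (↥(interiorSites H) × Fin 3 → ℝ) :=
  LinearMap.toContinuousLinearMap
    { toFun := thetaLinFun H W
      map_add' := thetaLinFun_add H W
      map_smul' := thetaLinFun_smul H W }

/-- Evaluation of `thetaLin`. -/
@[simp] theorem thetaLin_apply (H : ℕ) (W : LGConfig 4 SU2) (δ : ↥(interiorSites H) → Matrix (Fin 2) (Fin 2) ℂ) :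
    thetaLin H W δ = thetaLinFun H W δ := rfl

/-- The exact cross-term identity behind the remainder of `Θ̂` (per direction). -/
theorem cross_identity (a b b' Wm Wm' : Matrix (Fin 2) (Fin 2) ℂ) (c : Fin 3) :
    imVecM ((1 + a) * Wm * star (1 + b)) c - imVecM ((1 + b) * Wm' * star (1 + b')) c
      - (imVecM (1 * Wm * star 1) c - imVecM (1 * Wm' * star 1) c)
      - (imVecM (a * Wm + Wm * star b) c - imVecM (b * Wm' + Wm' * star b') c)
      = imVecM (a * Wm * star b) c - imVecM (b * Wm' * star b') c := by
  have hcross : ∀ (a₁ b₁ W₁ : Matrix (Fin 2) (Fin 2) ℂ),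
      (1 + a₁) * W₁ * star (1 + b₁) = W₁ + (a₁ * W₁ + W₁ * star b₁) + a₁ * W₁ * star b₁ := by
    intro a₁ b₁ W₁
    rw [star_add, star_one]
    noncomm_ring
  rw [hcross a b Wm, hcross b b' Wm', star_one, mul_one, one_mul, one_mul, mul_one]
  simp only [imVecM_add, Pi.add_apply]
  ring

/-- **The remainder of `Θ̂` at the identity is the exact bilinear cross term, `≤ 32‖δ‖²`.** -/
theorem norm_thetaHat_sub_sub_le (H : ℕ) (W : LGConfig 4 SU2) (δ : ↥(interiorSites H) → Matrix (Fin 2) (Fin 2) ℂ) :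
    ‖thetaHat H W ((fun _ => (1 : Matrix (Fin 2) (Fin 2) ℂ)) + δ) - thetaHat H W (fun _ => 1) - thetaLin H W δ‖ ≤ 32 * ‖δ‖ ^ 2 := by
  refine (pi_norm_le_iff_of_nonneg (by positivity)).2 fun p => ?_
  obtain ⟨x, c⟩ := p
  simp only [Pi.sub_apply, thetaLin_apply, thetaHat, thetaLinFun, extMat_one_add, extMat_one, Real.norm_eq_abs,
    ← Finset.sum_sub_distrib]
  refine (congrArg abs (Finset.sum_congr rfl fun μ _ => cross_identity (ext0 H δ ((x : Site 4) - Pi.single μ 1)) (ext0 H δ (x : Site 4))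
    (ext0 H δ ((x : Site 4) + Pi.single μ 1)) (W ((x : Site 4) - Pi.single μ 1, μ) : Matrix (Fin 2) (Fin 2) ℂ)
    (W ((x : Site 4), μ) : Matrix (Fin 2) (Fin 2) ℂ) c)).trans_le ?_
  have hbound : ∀ (a b Wm : Matrix (Fin 2) (Fin 2) ℂ), ‖a‖ ≤ ‖δ‖ → ‖b‖ ≤ ‖δ‖ → ‖Wm‖ ≤ 2 →
      |imVecM (a * Wm * star b) c| ≤ 4 * ‖δ‖ ^ 2 := by
    intro a b Wm ha hb hW
    refine (abs_imVecM_le_norm _ c).trans ?_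
    calc ‖a * Wm * star b‖ ≤ ‖a‖ * ‖Wm‖ * ‖star b‖ :=
          (norm_mul_le _ _).trans (mul_le_mul_of_nonneg_right (norm_mul_le _ _) (norm_nonneg _))
      _ ≤ ‖δ‖ * 2 * (2 * ‖δ‖) :=
          mul_le_mul (mul_le_mul ha hW (norm_nonneg _) (norm_nonneg _)) ((norm_star_le b).trans (by linarith))
            (norm_nonneg _) (by positivity)
      _ = 4 * ‖δ‖ ^ 2 := by ring
  refine (Finset.abs_sum_le_sum_abs _ _).trans ?_
  calc ∑ μ : Fin 4, |imVecM (ext0 H δ ((x : Site 4) - Pi.single μ 1) * (W ((x : Site 4) - Pi.single μ 1, μ) : Matrix (Fin 2) (Fin 2) ℂ)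
            * star (ext0 H δ (x : Site 4))) c
          - imVecM (ext0 H δ (x : Site 4) * (W ((x : Site 4), μ) : Matrix (Fin 2) (Fin 2) ℂ)
            * star (ext0 H δ ((x : Site 4) + Pi.single μ 1))) c|
      ≤ ∑ _μ : Fin 4, (4 * ‖δ‖ ^ 2 + 4 * ‖δ‖ ^ 2) := Finset.sum_le_sum fun μ _ =>
        (abs_sub _ _).trans (add_le_add
          (hbound _ _ _ (norm_ext0_le δ _) (norm_ext0_le δ _) (Parity.norm_coe_le_two _))
          (hbound _ _ _ (norm_ext0_le δ _) (norm_ext0_le δ _) (Parity.norm_coe_le_two _)))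
    _ = 32 * ‖δ‖ ^ 2 := by simp; ring

/-- ★ **`Θ̂` is differentiable at the identity with derivative `thetaLin`.** -/
theorem hasFDerivAt_thetaHat_one (H : ℕ) (W : LGConfig 4 SU2) :
    HasFDerivAt (thetaHat H W) (thetaLin H W) (fun _ => 1) := by
  refine hasFDerivAt_iff_isLittleO_nhds_zero.2 (Asymptotics.isLittleO_iff.2 fun ε hε => ?_)
  have hball : Metric.ball (0 : ↥(interiorSites H) → Matrix (Fin 2) (Fin 2) ℂ) (ε / 32) ∈ 𝓝 (0 : ↥(interiorSites H) → Matrix (Fin 2) (Fin 2) ℂ) :=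
    Metric.ball_mem_nhds _ (by positivity)
  filter_upwards [hball] with δ hδ
  rw [Metric.mem_ball, dist_zero_right] at hδ
  calc ‖thetaHat H W ((fun _ => 1) + δ) - thetaHat H W (fun _ => 1) - thetaLin H W δ‖ ≤ 32 * ‖δ‖ ^ 2 :=
        norm_thetaHat_sub_sub_le H W δ
    _ = (32 * ‖δ‖) * ‖δ‖ := by ring
    _ ≤ ε * ‖δ‖ := by
        refine mul_le_mul_of_nonneg_right ?_ (norm_nonneg _)
        rw [lt_div_iff₀ (by norm_num : (0:ℝ) < 32)] at hδ
        linarith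

/-! ## The right-trivialised chart `κ_A` -/

/-- Additivity of `X` on coordinate slices (entrywise; the tree's `su2Coord_add` lives in a module whose olean is not served). -/
theorem su2Coord_slice_add (H : ℕ) (y : ↥(interiorSites H)) (w w' : ↥(interiorSites H) × Fin 3 → ℝ) :
    su2Coord (fun c => (w + w') (y, c)) = su2Coord (fun c => w (y, c)) + su2Coord (fun c => w' (y, c)) := by
  ext i j
  fin_cases i <;> fin_cases j <;> simp [su2Coord] <;> ring

/-- Homogeneity of `X` on coordinate slices. -/
theorem su2Coord_slice_smul (H : ℕ) (y : ↥(interiorSites H)) (r : ℝ) (w : ↥(interiorSites H) × Fin 3 → ℝ) :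
    su2Coord (fun c => (r • w) (y, c)) = r • su2Coord (fun c => w (y, c)) := by
  ext i j
  fin_cases i <;> fin_cases j <;> simp [su2Coord, Complex.real_smul] <;> ring

/-- `X(a + b) = X(a) + X(b)` for Pauli vectors. -/
theorem su2Coord_ofLp_add (a b : EuclideanSpace ℝ (Fin 3)) :
    su2Coord (WithLp.ofLp (a + b)) = su2Coord (WithLp.ofLp a) + su2Coord (WithLp.ofLp b) := by
  ext i j
  fin_cases i <;> fin_cases j <;> simp [su2Coord] <;> ring

/-- `X` of the `y`-th Pauli coordinate slice, as a continuous linear map of the flat coordinate vector. -/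
def su2CoordCLM (H : ℕ) (y : ↥(interiorSites H)) : (↥(interiorSites H) × Fin 3 → ℝ) →L[ℝ] Matrix (Fin 2) (Fin 2) ℂ :=
  LinearMap.toContinuousLinearMap
    { toFun := fun w => su2Coord fun c => w (y, c)
      map_add' := fun w w' => su2Coord_slice_add H y w w'
      map_smul' := fun r w => by rw [RingHom.id_apply]; exact su2Coord_slice_smul H y r w }

/-- Evaluation of `su2CoordCLM`. -/
@[simp] theorem su2CoordCLM_apply (H : ℕ) (y : ↥(interiorSites H)) (w : ↥(interiorSites H) × Fin 3 → ℝ) :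
    su2CoordCLM H y w = su2Coord fun c => w (y, c) := rfl

/-- The Pauli coordinate of a flat vector: `X(♭⁻¹w y) = su2CoordCLM H y w`. -/
theorem su2Coord_vecToField (H : ℕ) (w : ↥(interiorSites H) × Fin 3 → ℝ) (y : ↥(interiorSites H)) :
    su2Coord (WithLp.ofLp (vecToField H w y)) = su2CoordCLM H y w := rfl

/-- **THE RIGHT-TRIVIALISED CHART at `A`**: `κ_A(w)_y = exp X(A_y + w_y) · exp(−X(A_y))`. [problem-side definition] -/
def chartK (H : ℕ) (A : ↥(interiorSites H) → EuclideanSpace ℝ (Fin 3)) (w : ↥(interiorSites H) × Fin 3 → ℝ)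
    (y : ↥(interiorSites H)) : Matrix (Fin 2) (Fin 2) ℂ :=
  exp (su2Coord (WithLp.ofLp (A y + vecToField H w y))) * exp (-su2Coord (WithLp.ofLp (A y)))

/-- `κ_A(0) ≡ 1`. -/
theorem chartK_zero (H : ℕ) (A : ↥(interiorSites H) → EuclideanSpace ℝ (Fin 3)) :
    chartK H A 0 = fun _ => 1 := by
  funext y
  have h0 : vecToField H (0 : ↥(interiorSites H) × Fin 3 → ℝ) y = 0 := by ext c; rfl
  rw [chartK, h0, add_zero]
  exact exp_mul_exp_neg_eq_one (𝕂 := ℝ) _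

/-- The derivative of the chart: `⊕_y gSer(ad(−X A_y)) ∘ X`. -/
def chartKDeriv (H : ℕ) (A : ↥(interiorSites H) → EuclideanSpace ℝ (Fin 3)) :
    (↥(interiorSites H) × Fin 3 → ℝ) →L[ℝ] (↥(interiorSites H) → Matrix (Fin 2) (Fin 2) ℂ) :=
  ContinuousLinearMap.pi fun y => (gSer ℝ (ad ℝ (-su2Coord (WithLp.ofLp (A y))))).comp (su2CoordCLM H y)

/-- Evaluation of `chartKDeriv`. -/
@[simp] theorem chartKDeriv_apply (H : ℕ) (A : ↥(interiorSites H) → EuclideanSpace ℝ (Fin 3)) (w : ↥(interiorSites H) × Fin 3 → ℝ)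
    (y : ↥(interiorSites H)) :
    chartKDeriv H A w y = gSer ℝ (ad ℝ (-su2Coord (WithLp.ofLp (A y)))) (su2Coord fun c => w (y, c)) := rfl

/-- ★ **The chart is differentiable at `0` with derivative `chartKDeriv`** (✓`hasFDerivAt_exp_mul_exp_neg`, per site). -/
theorem hasFDerivAt_chartK (H : ℕ) (A : ↥(interiorSites H) → EuclideanSpace ℝ (Fin 3)) :
    HasFDerivAt (chartK H A) (chartKDeriv H A) 0 := by
  rw [chartKDeriv]
  refine hasFDerivAt_pi.2 fun y => ?_
  set Xy : Matrix (Fin 2) (Fin 2) ℂ := su2Coord (WithLp.ofLp (A y)) with hXy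
  -- the affine inner map
  have hinner : HasFDerivAt (fun w : ↥(interiorSites H) × Fin 3 → ℝ => Xy + su2CoordCLM H y w) (su2CoordCLM H y) 0 :=
    ((su2CoordCLM H y).hasFDerivAt).const_add Xy
  have hz0 : (su2Coord fun _ : Fin 3 => (0 : ℝ)) = 0 := by
    ext i j; fin_cases i <;> fin_cases j <;> simp [su2Coord]
  have h0 : (fun w : ↥(interiorSites H) × Fin 3 → ℝ => Xy + su2CoordCLM H y w) 0 = Xy := by
    simp only [su2CoordCLM_apply, Pi.zero_apply, hz0, add_zero]
  have houter : HasFDerivAt (fun Y : Matrix (Fin 2) (Fin 2) ℂ => exp Y * exp (-Xy)) (gSer ℝ (ad ℝ (-Xy)))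
      ((fun w : ↥(interiorSites H) × Fin 3 → ℝ => Xy + su2CoordCLM H y w) 0) := by
    rw [h0]; exact hasFDerivAt_exp_mul_exp_neg (𝕂 := ℝ) Xy
  have hcomp := houter.comp (0 : ↥(interiorSites H) × Fin 3 → ℝ) hinner
  refine hcomp.congr_of_eventuallyEq (Eventually.of_forall fun w => ?_)
  show chartK H A w y = exp (Xy + su2CoordCLM H y w) * exp (-Xy)
  rw [chartK, hXy, su2Coord_ofLp_add, su2Coord_vecToField]

/-! ## The shift to the base point -/

/-- The interior transformation in Pauli coordinates, as matrices: `↑(pauliGauge H A z) = extMat H (exp X A) z`. -/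
theorem coe_pauliGauge (H : ℕ) (A : ↥(interiorSites H) → EuclideanSpace ℝ (Fin 3)) (z : Site 4) :
    ((pauliGauge H A z : SU2) : Matrix (Fin 2) (Fin 2) ℂ) = extMat H (fun y => exp (su2Coord (WithLp.ofLp (A y)))) z := by
  unfold pauliGauge
  by_cases hz : z ∈ interiorSites H
  · rw [extendGauge_of_mem _ hz, extMat_of_mem _ hz, coe_expPauli]
  · rw [extendGauge_of_not_mem _ hz, extMat_of_not_mem _ hz]; rfl

/-- `exp X` is unitary: `star (exp X(a)) * exp X(a) = 1` (as `exp(−X)·exp X`). -/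
theorem star_exp_su2Coord (a : EuclideanSpace ℝ (Fin 3)) :
    star (exp (su2Coord (WithLp.ofLp a))) = exp (-su2Coord (WithLp.ofLp a)) := by
  rw [star_exp, star_su2Coord]

/-- ★ **THE SHIFT**: the links of `V^{pauliGauge (A + ♭⁻¹w)}` are `κ_a · (V^{pauliGauge A})_e · κ_bᴴ`, `κ = chartK H A w` (extended by `1`). -/
theorem coe_gaugeTransformZd_pauliGauge_add (H : ℕ) (V : LGConfig 4 SU2) (A : ↥(interiorSites H) → EuclideanSpace ℝ (Fin 3))
    (w : ↥(interiorSites H) × Fin 3 → ℝ) (e : ZdEdge 4) :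
    ((gaugeTransformZd (pauliGauge H (A + vecToField H w)) V e : SU2) : Matrix (Fin 2) (Fin 2) ℂ)
      = extMat H (chartK H A w) e.1 * ((gaugeTransformZd (pauliGauge H A) V e : SU2) : Matrix (Fin 2) (Fin 2) ℂ)
          * star (extMat H (chartK H A w) (e.1 + Pi.single e.2 1)) := by
  -- both sides are `E'_a · V_e · E'_bᴴ`, `E' = exp X(A + B)`
  have hk : ∀ z : Site 4, extMat H (chartK H A w) z * ((pauliGauge H A z : SU2) : Matrix (Fin 2) (Fin 2) ℂ)
      = ((pauliGauge H (A + vecToField H w) z : SU2) : Matrix (Fin 2) (Fin 2) ℂ) := by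
    intro z
    rw [coe_pauliGauge, coe_pauliGauge]
    by_cases hz : z ∈ interiorSites H
    · have h1 : exp (-su2Coord (WithLp.ofLp (A ⟨z, hz⟩))) * exp (su2Coord (WithLp.ofLp (A ⟨z, hz⟩))) = (1 : Matrix (Fin 2) (Fin 2) ℂ) :=
        exp_neg_mul_exp_eq_one (𝕂 := ℝ) _
      rw [extMat_of_mem _ hz, extMat_of_mem _ hz, extMat_of_mem _ hz, chartK, mul_assoc, h1, mul_one]
      rfl
    · rw [extMat_of_not_mem _ hz, extMat_of_not_mem _ hz, extMat_of_not_mem _ hz, one_mul]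
  have hmul : ∀ x y : SU2, ((x * y : SU2) : Matrix (Fin 2) (Fin 2) ℂ) = (x : Matrix (Fin 2) (Fin 2) ℂ) * (y : Matrix (Fin 2) (Fin 2) ℂ) :=
    fun _ _ => rfl
  have hinv : ∀ x : SU2, ((x⁻¹ : SU2) : Matrix (Fin 2) (Fin 2) ℂ) = star (x : Matrix (Fin 2) (Fin 2) ℂ) := fun _ => rfl
  unfold gaugeTransformZd
  rw [hmul, hmul, hmul, hmul, hinv, hinv, ← hk e.1, ← hk (e.1 + Pi.single e.2 1), star_mul]
  simp only [mul_assoc]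

end OrbitChart

end Summit.QuantumFields.YangMills.Theorems.AllWindowsColdBoxBoxHighLine

end
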